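import Summits.HodgeConjecture.CorCM.AndreProductFormBiproduct
import Literature.AlgebraicGeometry.HodgeTheory.WeilClassesCMReductionProductForm
import Literature.AlgebraicGeometry.HodgeTheory.WeilClassesHodgeType
import Mathlib.LinearAlgebra.ExteriorPower.Basis
import HarnessLib

/-!
# COR-CM (cell `pub-hodgecm2`): the `K`-Weil-line space of a product of CM-typed realisations is
# the sum of its `[K:ℚ]` MONOMIAL LINES

HONEST FRAMING (cell pub-hodgecm2 / COR-CM, binder prover p2; count-neutral layer L4 "weights" of
lit-andre-3's sized ask A1): a STANDARD structure fact about the Betti cohomology of products of complex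
abelian varieties with complex multiplication, on the tree's real carriers; no case of the Hodge conjecture
is proved and nothing about algebraic cycles is asserted.

Setting (the slot products of André's product form, `HodgeTheory/WeilClassesCMReductionProductForm.lean`):
a number field `K`, slots `j : Fin d`, complex abelian varieties `A j` with `𝓞_K`-actions `act j` read on
`H¹` through `θ j`, realising CM types `Ψ j` (`ComplexMultiplication.IsCMTypeRealisation`), and eigenbases
`v j` of `H¹(A_j(ℂ); ℂ)`.  The **monomial** of the complex embedding `s : K → ℂ` is the iterated cup product
`μ_s = π_0^*(v 0 s) ⌣ ⋯ ⌣ π_{d-1}^*(v (d-1) s) ∈ H^d((⨁_j A_j)(ℂ); ℂ)` (`monomial`).  Results, all PROVED: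

* `map_diagonalAction_monomial` — the diagonal action of `a ∈ 𝓞_K` multiplies `μ_s` by `s(a)^d`;
* `iInf_eigenspace_le_span_monomial` — conversely the simultaneous eigenspace `⋂_a ker(a^* − s(a)^d)` on
  `H^d` is the line `ℂ · μ_s`: in the wedge basis of `H^d = ⋀^d H¹` (`wedgeBasis`, from
  `Motives.AbelianVariety.hasExteriorCohomologyH1_complexPoints` and Mathlib's `Basis.exteriorPower`) on the
  eigen-line basis `AndreProductForm.biprodBasis` of `H¹(⨁ A)`, `a` acts on the wedge monomial of a label
  set `S` by `∏_{(j,σ) ∈ S} σ(a)`, and `∏_{(j,σ)∈S} σ = s^d` on `𝓞_K` forces all labels of `S` to carry `s`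
  (`eq_of_forall_prod_eq_pow`: evaluate at `n + a₀`, `a₀` a separating integer, and compare roots);
* `weilLineClasses_eq_iSup_span_monomial` — **`weilLineClasses A act d = ⨆_s ℂ · μ_s`**: the complexified
  `K`-Weil line `(⋀^d_K H¹(⨁ A, ℚ)) ⊗ ℂ` of Deligne / Moonen–Zarhin / Milne, line by line;
* `monomial_ne_zero`, `linearIndependent_monomial`, `finrank_weilLineClasses` (`= [K:ℚ]`), and
  `isOfHodgeType_monomial`: `μ_s` has Hodge type `(#{j : s ∈ Ψ_j}, #{j : s ∉ Ψ_j})`.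

References: [Deligne1982HodgeCycles] LNM 900 (1982), §4 (4.4) and endnote M.12; [MoonenZarhin1998WeilClasses]
J. reine angew. Math. 496 (1998), §1; [Milne2020HodgeClassesAV] 2.1–2.2 and Thm. 1 (proof);
[LangeBirkenhake1992] Lemma 1.1.17; [CharlesSchnell2014Notes] Prop. 11.5.20.
-/


noncomputable section

namespace Summit.HodgeConjecture.CorCM.WeilLineMonomial

open CategoryTheory CategoryTheory.Limits NumberField Polynomial
open Literature.AlgebraicTopology.SingularHomology
open Literature.AlgebraicGeometry Literature.AlgebraicGeometry.Motives Literature.AlgebraicGeometry.HodgeTheory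
open Literature.AlgebraicGeometry.ComplexMultiplication
open Literature.NumberTheory.Automorphic.PicardCM (eigenline)
open Summit.HodgeConjecture.CorCM.AndreProductForm

variable {K : Type} [Field K] [NumberField K]

/-! ## Character separation: a label set with character `s^d` is constant `s` -/

/-- **Separation of monomial characters.** If complex embeddings `σ i` (`i ∈ S`) of the number field `K`
satisfy `∏_{i ∈ S} σ_i(a) = s(a)^{#S}` for every algebraic integer `a`, then every `σ i` equals `s`.
(Evaluate at `a = n + a₀` for an integer `a₀` separating the embeddings: the polynomials
`∏ (X + σ_i(a₀))` and `(X + s(a₀))^{#S}` agree at every natural number, hence are equal, hence have the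
same roots.) [cite: Milne2020HodgeClassesAV, 2.1–2.2] -/
theorem eq_of_forall_prod_eq_pow {ι : Type*} (S : Finset ι) (σ : ι → (K →+* ℂ)) (s : K →+* ℂ)
    (h : ∀ a : 𝓞 K, ∏ i ∈ S, σ i (a : K) = (s (a : K)) ^ S.card) : ∀ i ∈ S, σ i = s := by
  classical
  obtain ⟨a₀, hsep⟩ := exists_integer_separating K
  -- the two polynomials
  set P : ℂ[X] := ∏ i ∈ S, (X + C (σ i (a₀ : K))) with hP
  set Q : ℂ[X] := (X + C (s (a₀ : K))) ^ S.card with hQ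
  have hPQ : P = Q := by
    apply Polynomial.eq_of_infinite_eval_eq
    refine Set.Infinite.mono ?_ (Set.infinite_range_of_injective (Nat.cast_injective (R := ℂ)))
    rintro _ ⟨n, rfl⟩
    have hn := h ((n : 𝓞 K) + a₀)
    simp only [map_add, map_natCast] at hn
    simp only [Set.mem_setOf_eq, hP, hQ, eval_prod, eval_add, eval_X, eval_C, eval_pow]
    simpa [RingOfIntegers.coe_eq_algebraMap] using hn
  -- roots
  have hQroots : Q.roots = Multiset.replicate S.card (-(s (a₀ : K))) := by
    rw [hQ, roots_pow, roots_X_add_C, Multiset.nsmul_singleton]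
  have hPne : P ≠ 0 := by
    rw [hPQ, hQ]
    exact pow_ne_zero _ (X_add_C_ne_zero _)
  have hProots : P.roots = S.val.map fun i => -(σ i (a₀ : K)) := by
    rw [hP, roots_prod _ _ (hP ▸ hPne)]
    simp only [roots_X_add_C, Multiset.bind_singleton]
  intro i hi
  have hmem : -(σ i (a₀ : K)) ∈ P.roots := by
    rw [hProots]
    exact Multiset.mem_map_of_mem _ hi
  rw [hPQ, hQroots] at hmem
  have heq := Multiset.eq_of_mem_replicate hmem
  exact hsep (neg_injective heq)

/-! ## The monomials -/

section Monomial

variable {d : ℕ} (A : Fin d → AbelianVariety ℂ) (act : ∀ j, 𝓞 K →+* End (A j))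
  {θ : ∀ j, K →+* Module.End ℂ (complexBetti (A j).X 1)} {Ψ : Fin d → CMType K}
  (v : ∀ j, Module.Basis (K →+* ℂ) ℂ (complexBetti (A j).X 1))

/-- The **monomial** `μ_s = π_0^*(v 0 s) ⌣ ⋯ ⌣ π_{d-1}^*(v (d-1) s) ∈ H^d((⨁_j A_j)(ℂ); ℂ)` of a complex
embedding `s` (iterated cup product, the tree's `cupPowOne`, of the `s`-members of the eigen-line basis
`biprodBasis A v (j, s) = π_j^*(v j s)` of `H¹`). [cite: Milne2020HodgeClassesAV, 2.1–2.2] -/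
def monomial (s : K →+* ℂ) : complexBetti (⨁ A).X d :=
  cupPowOne ℂ (ComplexPoints (⨁ A).X) d fun j => biprodBasis A v (j, s)

/-- Unfolding of `monomial`. [folklore] -/
theorem monomial_def (s : K →+* ℂ) :
    monomial A v s = cupPowOne ℂ (ComplexPoints (⨁ A).X) d fun j => biprodBasis A v (j, s) :=
  rfl

/-- **Monomials are non-zero** (`H• = ⋀• H¹` for an abelian variety and the factors are distinct members
of a basis). [cite: LangeBirkenhake1992, Lemma 1.1.17] -/
theorem monomial_ne_zero (s : K →+* ℂ) : monomial A v s ≠ 0 :=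
  cupPowOne_ne_zero_of_linearIndependent (⨁ A)
    ((biprodBasis A v).linearIndependent.comp (fun j : Fin d => (j, s))
      fun _ _ h => (Prod.mk.inj h).1)

variable {A act v}

/-- **The diagonal action on a monomial**: `a^* μ_s = s(a)^d · μ_s` (`a^*` is a ring homomorphism and
`a^*(π_j^* v j s) = s(a) π_j^* v j s`). [cite: Milne2020HodgeClassesAV, Theorem 1 (proof)] -/
theorem map_diagonalAction_monomial (hA : ∀ j, IsCMTypeRealisation (Ψ j) (A j) (act j) (θ j))
    (hv : ∀ j σ, v j σ ∈ eigenline (θ j) σ) (a : 𝓞 K) (s : K →+* ℂ) :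
    complexBetti.map (diagonalAction A act a).hom.hom.hom d (monomial A v s) =
      ((s (a : K)) ^ d) • monomial A v s := by
  rw [monomial_def, complexBetti_map_cupPowOne]
  have e : (fun j => complexBetti.map (diagonalAction A act a).hom.hom.hom 1 (biprodBasis A v (j, s))) =
      fun j => (s (a : K)) • biprodBasis A v (j, s) :=
    funext fun j => map_diagHom_biprodBasis K A act hA hv a j s
  rw [e, MultilinearMap.map_smul_univ, Finset.prod_const, Finset.card_univ, Fintype.card_fin]

/-- A monomial lies in the `s`-summand of the `K`-Weil-line space. [cite: Milne2020HodgeClassesAV, Theorem 1 (proof)] -/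
theorem monomial_mem_iInf_eigenspace (hA : ∀ j, IsCMTypeRealisation (Ψ j) (A j) (act j) (θ j))
    (hv : ∀ j σ, v j σ ∈ eigenline (θ j) σ) (s : K →+* ℂ) :
    monomial A v s ∈ ⨅ a : 𝓞 K, Module.End.eigenspace
      (complexBetti.map (diagonalAction A act a).hom.hom.hom d).hom ((s a) ^ d) := by
  refine (Submodule.mem_iInf _).2 fun a => Module.End.mem_eigenspace_iff.2 ?_
  exact map_diagonalAction_monomial hA hv a s

/-- A monomial is a `K`-Weil-line class. [cite: Milne2020HodgeClassesAV, Theorem 1 (proof)] -/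
theorem monomial_mem_weilLineClasses (hA : ∀ j, IsCMTypeRealisation (Ψ j) (A j) (act j) (θ j))
    (hv : ∀ j σ, v j σ ∈ eigenline (θ j) σ) (s : K →+* ℂ) :
    monomial A v s ∈ weilLineClasses A act d :=
  iInf_eigenspace_le_weilLineClasses A act d s (monomial_mem_iInf_eigenspace hA hv s)

open scoped Classical in
/-- **Hodge type of a monomial**: `μ_s` is of type `(#{j : s ∈ Ψ_j}, #{j : s ∉ Ψ_j})` — the `s`-eigenvector
of slot `j` is of type `(1,0)` if `s ∈ Ψ_j` and `(0,1)` otherwise, pull-backs preserve types and types add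
along cup products (`isOfHodgeType_cupPowOne`). [cite: Milne2020HodgeClassesAV, Theorem 1 (proof)]
[cite: CharlesSchnell2014Notes, Prop. 11.5.20] -/
theorem isOfHodgeType_monomial (hA : ∀ j, IsCMTypeRealisation (Ψ j) (A j) (act j) (θ j))
    (hv : ∀ j σ, v j σ ∈ eigenline (θ j) σ) (hd : 0 < d) (s : K →+* ℂ) :
    IsOfHodgeType (⨁ A).dim (⨁ A).X d (Finset.univ.filter fun j => s ∈ (Ψ j).1).card
      (Finset.univ.filter fun j => s ∉ (Ψ j).1).card (monomial A v s) := by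
  classical
  have hB : IsSmoothProjective (⨁ A).dim (⨁ A).X := AbelianVariety.isSmoothProjective_holds
  have hw : ∀ j, IsOfHodgeType (⨁ A).dim (⨁ A).X 1 (if s ∈ (Ψ j).1 then 1 else 0)
      (if s ∉ (Ψ j).1 then 1 else 0) (biprodBasis A v (j, s)) := by
    intro j
    rw [biprodBasis_apply]
    by_cases hj : s ∈ (Ψ j).1
    · rw [if_pos hj, if_neg (not_not.2 hj)]
      exact (isOfHodgeType_oneZero_of_mem (hA j) (hv j s) hj).map_of_isSmoothProjective hB
        AbelianVariety.isSmoothProjective_holds _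
    · rw [if_neg hj, if_pos hj]
      exact (isOfHodgeType_zeroOne_of_not_mem (hA j) (hv j s) hj).map_of_isSmoothProjective hB
        AbelianVariety.isSmoothProjective_holds _
  rw [Finset.card_filter, Finset.card_filter]
  exact isOfHodgeType_cupPowOne hB hd (fun j => biprodBasis A v (j, s)) _ _ hw

end Monomial

/-! ## The wedge basis of `H^d(⨁ A)` and the diagonal action on it -/

section Wedge

variable {I : Type} [LinearOrder I] (B : AbelianVariety ℂ) (𝔅 : Module.Basis I ℂ (complexBetti B.X 1)) (d : ℕ)

/-- The wedge basis of `H^d(B(ℂ); ℂ) = ⋀^d H¹(B(ℂ); ℂ)` on a basis `𝔅` of `H¹` indexed by a linearly ordered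
type (Mathlib's `Basis.exteriorPower` transported along the comparison isomorphism
`Motives.AbelianVariety.hasExteriorCohomologyH1_complexPoints`). [cite: LangeBirkenhake1992, Lemma 1.1.17] -/
def wedgeBasis : Module.Basis (Set.powersetCard I d) ℂ (complexBetti B.X d) :=
  (𝔅.exteriorPower d).map ((AbelianVariety.hasExteriorCohomologyH1_complexPoints B).equiv d)

/-- The wedge basis vector of `S` is the iterated cup product over the increasing enumeration of `S`.
[cite: LangeBirkenhake1992, Lemma 1.1.17] -/
theorem wedgeBasis_apply (S : Set.powersetCard I d) :
    wedgeBasis B 𝔅 d S = cupPowOne ℂ (ComplexPoints B.X) d (𝔅 ∘ (Set.powersetCard.ofFinEmbEquiv.symm S)) := by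
  change (AbelianVariety.hasExteriorCohomologyH1_complexPoints B).equiv d ((𝔅.exteriorPower d) S) = _
  rw [exteriorPower.basis_apply, HasExteriorCohomologyH1.equiv_apply, exteriorPower.ιMulti_family,
    wedgeToCup_ιMulti]

/-- **An endomorphism diagonal on `𝔅` is diagonal on the wedge basis**, with eigenvalue `∏_{i ∈ S} a_i` on
the wedge monomial of `S` (naturality of iterated cup products; the pattern of the tree's
`CMPivotAndre.exists_andreWedgeBasis`). [cite: LangeBirkenhake1992, Lemma 1.1.17] -/
theorem map_wedgeBasis_of_diag (f : B ⟶ B) (a : I → ℂ)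
    (ha : ∀ i, complexBetti.map f.hom.hom.hom 1 (𝔅 i) = a i • 𝔅 i) (S : Set.powersetCard I d) :
    complexBetti.map f.hom.hom.hom d (wedgeBasis B 𝔅 d S) =
      (∏ i ∈ (S : Finset I), a i) • wedgeBasis B 𝔅 d S := by
  classical
  rw [wedgeBasis_apply, complexBetti_map_cupPowOne]
  have e : (fun i => complexBetti.map f.hom.hom.hom 1 ((𝔅 ∘ (Set.powersetCard.ofFinEmbEquiv.symm S)) i)) =
      fun i => a (Set.powersetCard.ofFinEmbEquiv.symm S i) • (𝔅 ∘ (Set.powersetCard.ofFinEmbEquiv.symm S)) i :=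
    funext fun i => ha _
  rw [e, MultilinearMap.map_smul_univ]
  congr 1
  have hinj : Function.Injective (Set.powersetCard.ofFinEmbEquiv.symm S) :=
    (Set.powersetCard.ofFinEmbEquiv.symm S).injective
  rw [← Finset.prod_image (f := a) hinj.injOn]
  refine Finset.prod_congr ?_ fun _ _ => rfl
  ext i
  rw [Finset.mem_image]
  constructor
  · rintro ⟨k, _, rfl⟩
    exact (Set.powersetCard.mem_range_ofFinEmbEquiv_symm_iff_mem S _).1 ⟨k, rfl⟩
  · intro hi
    obtain ⟨k, hk⟩ := (Set.powersetCard.mem_range_ofFinEmbEquiv_symm_iff_mem S i).2 hi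
    exact ⟨k, Finset.mem_univ _, hk⟩

/-- Coordinates along an eigenbasis: if `f (b i) = c_i • b i` for all `i`, then the `i`-th coordinate of
`f x` is `c_i` times that of `x`. [folklore] -/
theorem repr_apply_of_diag {ι M : Type*} [AddCommGroup M] [Module ℂ M] (b : Module.Basis ι ℂ M)
    (f : M →ₗ[ℂ] M) (c : ι → ℂ) (hf : ∀ i, f (b i) = c i • b i) (x : M) (i : ι) :
    b.repr (f x) i = c i * b.repr x i := by
  classical
  have key : (b.coord i) ∘ₗ f = c i • b.coord i := by
    refine b.ext fun j => ?_
    simp only [LinearMap.coe_comp, Function.comp_apply, hf, map_smul, Module.Basis.coord_apply,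
      Module.Basis.repr_self, LinearMap.smul_apply, smul_eq_mul, Finsupp.single_apply]
    by_cases hij : j = i
    · subst hij; simp
    · simp [hij]
  have := LinearMap.congr_fun key x
  simpa [Module.Basis.coord_apply] using this

end Wedge

/-! ## The simultaneous eigenspaces are the monomial lines -/

section Lines

variable {d : ℕ} {A : Fin d → AbelianVariety ℂ} {act : ∀ j, 𝓞 K →+* End (A j)}
  {θ : ∀ j, K →+* Module.End ℂ (complexBetti (A j).X 1)} {Ψ : Fin d → CMType K}
  {v : ∀ j, Module.Basis (K →+* ℂ) ℂ (complexBetti (A j).X 1)}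

omit [NumberField K] in
/-- The label set `Fin d × {s}` of the monomial `μ_s`, a `d`-element set of labels. [folklore] -/
def slotSet (d : ℕ) (s : K →+* ℂ) : Set.powersetCard (Fin d × (K →+* ℂ)) d :=
  ⟨Finset.univ ×ˢ {s}, by simp⟩

omit [NumberField K] in
/-- Membership in `slotSet`. [folklore] -/
theorem mem_slotSet_iff (s : K →+* ℂ) (i : Fin d × (K →+* ℂ)) :
    i ∈ (slotSet d s : Finset (Fin d × (K →+* ℂ))) ↔ i.2 = s := by
  change i ∈ Finset.univ ×ˢ ({s} : Finset (K →+* ℂ)) ↔ _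
  rw [Finset.mem_product]
  simp only [Finset.mem_univ, Finset.mem_singleton, true_and]

omit [NumberField K] in
/-- `s ↦ Fin d × {s}` is injective for `d ≥ 1`. [folklore] -/
theorem slotSet_injective (hd : 0 < d) : Function.Injective (slotSet (K := K) d) := by
  intro s s' h
  have hm : ((⟨0, hd⟩ : Fin d), s) ∈ (slotSet d s' : Finset (Fin d × (K →+* ℂ))) := by
    rw [← h, mem_slotSet_iff]
  exact (mem_slotSet_iff s' _).1 hm

/-- An auxiliary SLOT-DOMINANT linear order on the labels `Fin d × (K →+* ℂ)` (lexicographic, slots first,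
embeddings in an arbitrary enumeration); used only to enumerate label sets for the wedge basis. [folklore] -/
@[reducible] def labelOrder (K : Type) [Field K] [NumberField K] (d : ℕ) : LinearOrder (Fin d × (K →+* ℂ)) :=
  letI : LinearOrder (K →+* ℂ) :=
    LinearOrder.lift' (Fintype.equivFin (K →+* ℂ)) (Fintype.equivFin (K →+* ℂ)).injective
  LinearOrder.lift' (toLex : Fin d × (K →+* ℂ) → Lex (Fin d × (K →+* ℂ))) toLex.injective

/-- In the slot-dominant order, `k ↦ (k, s)` is strictly increasing. [folklore] -/
theorem strictMono_slot (s : K →+* ℂ) :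
    letI := labelOrder K d
    StrictMono fun k : Fin d => (k, s) := by
  letI : LinearOrder (K →+* ℂ) :=
    LinearOrder.lift' (Fintype.equivFin (K →+* ℂ)) (Fintype.equivFin (K →+* ℂ)).injective
  intro k k' hk
  change toLex (k, s) < toLex (k', s)
  rw [Prod.Lex.toLex_lt_toLex]
  exact Or.inl hk

/-- In any linear order on the labels in which `k ↦ (k, s)` is increasing, the wedge monomial of the label
set `Fin d × {s}` is `μ_s`. [cite: LangeBirkenhake1992, Lemma 1.1.17] -/
theorem wedgeBasis_slotSet [LinearOrder (Fin d × (K →+* ℂ))] (s : K →+* ℂ)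
    (hmono : StrictMono fun k : Fin d => (k, s)) :
    wedgeBasis (⨁ A) (biprodBasis A v) d (slotSet d s) = monomial A v s := by
  have henum : (fun k : Fin d => (k, s)) =
      ⇑(Set.powersetCard.ofFinEmbEquiv.symm (slotSet d s) : Fin d ↪o Fin d × (K →+* ℂ)) := by
    rw [Set.powersetCard.ofFinEmbEquiv_symm_apply]
    exact Finset.orderEmbOfFin_unique (slotSet d s).prop (fun k => (mem_slotSet_iff s _).2 rfl) hmono
  rw [wedgeBasis_apply, monomial_def]
  congr 1
  funext k
  change biprodBasis A v ((Set.powersetCard.ofFinEmbEquiv.symm (slotSet d s)) k) = _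
  rw [← henum]

/-- **The `s`-summand of the `K`-Weil-line space is the monomial line `ℂ · μ_s`.** In the wedge basis on
the eigen-line basis of `H¹(⨁ A)` the diagonal action of `a ∈ 𝓞_K` has eigenvalue `∏_{(j,σ) ∈ S} σ(a)` on
the wedge monomial of the label set `S`; a non-zero coordinate of a simultaneous `s(a)^d`-eigenvector
forces `∏_{(j,σ)∈S} σ = s^d` on `𝓞_K`, hence (`eq_of_forall_prod_eq_pow`) all labels of `S` carry the
embedding `s`, i.e. `S = Fin d × {s}`, whose wedge monomial is `μ_s`.
[cite: Milne2020HodgeClassesAV, 2.1–2.2 and Theorem 1 (proof)] [cite: Deligne1982HodgeCycles, §4 (4.4)] -/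
theorem iInf_eigenspace_le_span_monomial (hA : ∀ j, IsCMTypeRealisation (Ψ j) (A j) (act j) (θ j))
    (hv : ∀ j σ, v j σ ∈ eigenline (θ j) σ) (s : K →+* ℂ) :
    (⨅ a : 𝓞 K, Module.End.eigenspace
        (complexBetti.map (diagonalAction A act a).hom.hom.hom d).hom ((s a) ^ d)) ≤
      ℂ ∙ monomial A v s := by
  classical
  letI := labelOrder K d
  -- the wedge basis on the eigen-line basis of `H¹(⨁ A)` and the diagonal action on it
  let Bw := wedgeBasis (⨁ A) (biprodBasis A v) d
  have hact : ∀ (a : 𝓞 K) (S : Set.powersetCard (Fin d × (K →+* ℂ)) d),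
      complexBetti.map (diagonalAction A act a).hom.hom.hom d (Bw S) =
        (∏ i ∈ (S : Finset (Fin d × (K →+* ℂ))), i.2 (a : K)) • Bw S :=
    fun a S => map_wedgeBasis_of_diag (⨁ A) (biprodBasis A v) d (diagonalAction A act a)
      (fun i => i.2 (a : K)) (fun i => map_diagHom_biprodBasis K A act hA hv a i.1 i.2) S
  have hS₀ : Bw (slotSet d s) = monomial A v s := wedgeBasis_slotSet s (strictMono_slot s)
  -- coordinates of a simultaneous eigenvector vanish off `slotSet d s`
  intro x hx
  rw [Submodule.mem_iInf] at hx
  have hcoord : ∀ S, S ≠ slotSet d s → Bw.repr x S = 0 := by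
    intro S hS
    by_contra hc
    apply hS
    have hchar : ∀ a : 𝓞 K, ∏ i ∈ (S : Finset (Fin d × (K →+* ℂ))), i.2 (a : K) = (s (a : K)) ^ d := by
      intro a
      have h1 := Module.End.mem_eigenspace_iff.1 (hx a)
      have h2 := repr_apply_of_diag Bw (complexBetti.map (diagonalAction A act a).hom.hom.hom d).hom
        (fun T => ∏ i ∈ (T : Finset (Fin d × (K →+* ℂ))), i.2 (a : K)) (fun T => hact a T) x S
      rw [h1, map_smul, Finsupp.smul_apply, smul_eq_mul] at h2
      exact (mul_right_cancel₀ hc h2).symm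
    have hlab := eq_of_forall_prod_eq_pow (S : Finset (Fin d × (K →+* ℂ))) (fun i => i.2) s
      (fun a => by rw [Set.powersetCard.card_eq]; exact hchar a)
    rw [Set.powersetCard.eq_iff_subset]
    intro i hi
    exact (mem_slotSet_iff s i).2 (hlab i hi)
  -- hence `x = (repr x S₀) • μ_s`
  rw [Submodule.mem_span_singleton]
  refine ⟨Bw.repr x (slotSet d s), ?_⟩
  conv_rhs => rw [← Bw.sum_repr x]
  rw [Finset.sum_eq_single (slotSet d s) (fun S _ hS => by rw [hcoord S hS, zero_smul])
    (fun h => absurd (Finset.mem_univ _) h), hS₀]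

/-- **The simultaneous eigenspace for `s` IS the monomial line** (both inclusions).
[cite: Milne2020HodgeClassesAV, 2.1–2.2 and Theorem 1 (proof)] -/
theorem iInf_eigenspace_eq_span_monomial (hA : ∀ j, IsCMTypeRealisation (Ψ j) (A j) (act j) (θ j))
    (hv : ∀ j σ, v j σ ∈ eigenline (θ j) σ) (s : K →+* ℂ) :
    (⨅ a : 𝓞 K, Module.End.eigenspace
        (complexBetti.map (diagonalAction A act a).hom.hom.hom d).hom ((s a) ^ d)) =
      ℂ ∙ monomial A v s :=
  le_antisymm (iInf_eigenspace_le_span_monomial hA hv s)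
    ((Submodule.span_singleton_le_iff_mem _ _).2 (monomial_mem_iInf_eigenspace hA hv s))

/-- **The `K`-Weil-line space of a product of CM-typed realisations is the sum of its monomial lines**:
`weilLineClasses A act d = ⨆_{s : K → ℂ} ℂ · μ_s` — the complexified `K`-Weil line
`(⋀^d_K H¹(⨁ A, ℚ)) ⊗ ℂ = ⊕_s ⊗_j L_{j,s}` line by line.
[cite: Milne2020HodgeClassesAV, 2.1–2.2 and Theorem 1 (proof)] [cite: Deligne1982HodgeCycles, §4 (4.4) and endnote M.12]
[cite: MoonenZarhin1998WeilClasses, §1] -/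
theorem weilLineClasses_eq_iSup_span_monomial (hA : ∀ j, IsCMTypeRealisation (Ψ j) (A j) (act j) (θ j))
    (hv : ∀ j σ, v j σ ∈ eigenline (θ j) σ) :
    weilLineClasses A act d = ⨆ s : K →+* ℂ, ℂ ∙ monomial A v s := by
  unfold weilLineClasses
  exact iSup_congr fun s => iInf_eigenspace_eq_span_monomial hA hv s

/-- The `K`-Weil-line space is the span of the monomials. [cite: Milne2020HodgeClassesAV, 2.1–2.2] -/
theorem weilLineClasses_eq_span_range_monomial (hA : ∀ j, IsCMTypeRealisation (Ψ j) (A j) (act j) (θ j))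
    (hv : ∀ j σ, v j σ ∈ eigenline (θ j) σ) :
    weilLineClasses A act d = Submodule.span ℂ (Set.range (monomial A v)) := by
  rw [weilLineClasses_eq_iSup_span_monomial hA hv, Submodule.span_range_eq_iSup]

/-- **The monomials are linearly independent** for `d ≥ 1` (they are distinct vectors of the wedge basis).
[cite: Deligne1982HodgeCycles, §4 (4.4)] -/
theorem linearIndependent_monomial (hd : 0 < d) : LinearIndependent ℂ (monomial A v) := by
  classical
  letI := labelOrder K d
  have e : monomial A v = wedgeBasis (⨁ A) (biprodBasis A v) d ∘ slotSet d :=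
    funext fun s => (wedgeBasis_slotSet s (strictMono_slot s)).symm
  rw [e]
  exact (wedgeBasis (⨁ A) (biprodBasis A v) d).linearIndependent.comp _ (slotSet_injective hd)

/-- **`dim_ℂ (weilLineClasses A act d) = [K:ℚ]`** for `d ≥ 1` (the `K`-Weil line is a `K`-line:
`dim_ℚ ⋀^d_K H¹ = [K:ℚ]`). [cite: Deligne1982HodgeCycles, §4 (4.4)] [cite: MoonenZarhin1998WeilClasses, §1] -/
theorem finrank_weilLineClasses (hA : ∀ j, IsCMTypeRealisation (Ψ j) (A j) (act j) (θ j))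
    (hv : ∀ j σ, v j σ ∈ eigenline (θ j) σ) (hd : 0 < d) :
    Module.finrank ℂ (weilLineClasses A act d) = Module.finrank ℚ K := by
  rw [weilLineClasses_eq_span_range_monomial hA hv, finrank_span_eq_card (linearIndependent_monomial hd),
    NumberField.Embeddings.card]

end Lines

end Summit.HodgeConjecture.CorCM.WeilLineMonomial

end
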